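import Summits.QuantumFields.BalabanUV.T4Continuum.Spine.NE4.KingCurrency
import Summits.QuantumFields.BalabanUV.T4Continuum.Spine.NE4.KingCurrencyAF
import Summits.QuantumFields.BalabanUV.T4Continuum.Spine.NE9.DirectPairing
import Summits.QuantumFields.BalabanUV.T4Continuum.Support.NE7PairwiseCouplingStep

/-!
# Spine/NE4/KingCurrencyWindow — node U2 in King's currency, the END on the runs: two pinned runs `n` cutoffs apart match at every
# fixed depth below the infrared end for large cutoffs, UNIFORMLY in `n`, from the RATE-FREE β-side input `UniformShift ω`, `ω → 0`

Cell `pub-balaban-gaps` (YM blitz G2), seat `ne4` generation 13 (unit `pub-balaban-gaps-ne4-g13`), record `HOME/ne/NE4.md` §5 census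
item (R51); sequel of `Spine/NE4/KingCurrency` (§1 the shape `UniformShift`, §2 the direct recursion `discAt_step`, §3 the
infrared-anchored fixed point `king_fixedPoint`), whose declarations are consumed BY NAME.

WHAT THIS FILE ADDS (kernel bookkeeping, elementary real analysis; NOTHING of Bałaban's asserted):
* §4 `discAt_le_window` — NODE U2 IN KING'S CURRENCY (the asymptotic-freedom weight sum for the pair `(K, K+n)`,
  `Σ_{i≤K}(g^A_i)² g^B_{i+n} ≤ (k₀+1)γ³ + 2γ∕b`, is the tree's `NE7PairwiseCouplingStep.sum_weightsOff_le_of_eventualLower`, consumed BY NAME): two runs of (0.20) `n` cutoffs apart, pinned,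
  couplings in `]0,γ]`, `UniformShift ω` (`ω ≥ 0`), `HistLipschitz Λ` with `FadingMemory C θ Λ`, `EventualLowerH b γ k₀` and the
  consecutive kernel's smallness `C((k₀+1)γ³ + 2γ∕b) ≤ (1−θ)∕2` give on every infrared window `[J, K]`, UNIFORMLY IN `n`,
  `|1∕(g^A_j)² − 1∕(g^B_{j+n})²| ≤ 2·Σ_{i∈[J,K)} ω_i + 2(C∕(1−θ))·Σ_{i<J} θ^{J−i}|g^B_{i+n} − g^A_i|`.
* §5 the far-ultraviolet term is small by ASYMPTOTIC FREEDOM: below the window both runs' couplings are `≤ 1∕√(1∕γ² + b·depth)`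
  (`KingCurrencyAF.coupling_le_inv_sprof`), so
  `Σ_{i<J} θ^{J−i}|g^B_{i+n} − g^A_i| ≤ k₀γ·θ^{J−k₀} + (θ∕(1−θ))∕sprof γ b (K+1−J)` (`farUV_le`);
  and the qualitative END `direct_matching_eventually`: for a family of tuned runs `K ↦ g^{(K)}` (pinned `g^{(K)}_K = g_IR`), every
  depth `M` and every `ε > 0` there is `K₀` with `|g^{(K+n)}_{j+n} − g^{(K)}_j| ≤ ε` for all `K ≥ K₀`, ALL `n`, and `K − M ≤ j ≤ K` —
  the couplings of the runs `K` and `K + n` match at every fixed infrared depth, uniformly in the gap, with NO RATE asked of or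
  delivered by the β-side (only `ω → 0`).  This is the input currency of `Spine/NE4/KingCurrencyTransport` (node U6's transport of an
  infrared-anchored profile and ne9's E-side bracket re-cut to the anchored form: `irAnchored_bracket`, `cauchySeq_genFun_of_directMatching`).
(The witness `KingCurrency.harmonicOsc` — King-admissible, violating NE4 at every rate — has single shifts `= 1∕(k+2) + 1∕(k+1)`
(`harmonicOsc_shift`), so it admits no summable envelope either: the King-currency input is strictly weaker than the ℓ¹ currency of
(R9′) as well.  The asymptotic-freedom envelope helpers live in `Spine/NE4/KingCurrencyAF`.)

PRIOR ART IN THE TREE (credit; found through the gate's dedup on the weight sum).  The pub-balaban NE7 #2 crux lineage's route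
«PAIR-CAUCHY» (`Support/NE7Pairwise*`, b2b-balaban-t4-ne7-p2 gens 48–49, 2026-08-21∕22) already runs node U2 on the cutoff pair with
a rate-free n-layer scale-shift modulus: `NE7PairwiseScaleShift` (σ) is `KingCurrency.UniformShift` verbatim, `NE7PairwiseCouplingStep.discOff_step`
is `KingCurrency.discAt_step`, and `NE7PairwiseMarginalBox.marginalBox_tendsto_zero` ∕ `NE7PairwiseCouplingDock.couplingGap_tendsto_zero` ∕
`NE7PairwiseCouplingUniform.couplingGap_uniform` give the conclusion of `direct_matching_eventually` below (by an iterated rate-free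
marginal lemma with the printed box and an affine a-priori bound from `BetaUpperH`; here by the window bootstrap `KingCurrency.king_fixedPoint`,
without `BetaUpperH` in the estimate — it enters only to run (0.20) forward at the data level).  This file is therefore an INDEPENDENT
RE-DERIVATION in the (R51) chain's own currency, kept because `KingCurrencyClosed` ∕ `KingCurrencyTargets` compose it BY NAME with
`KingCurrencyPointwise` (the Arzelà–Ascoli upgrade, which is new) and `KingCurrencyTransport` (the bridge to ne9's tower, new).

WHAT THIS SAYS FOR THE ROW (R51).  On King's route the β-side NEED of the apex is c₀ — uniform (in the history box) convergence of
`β_k` as the cutoff is removed — NOT ℓ¹ and NOT geometric; NE4 PROPER unchanged (NOT PRINTED, NOT PROVED, DEPENDENT).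

HONEST FRAMING.  Hypothesis SHAPES only (0 sorry, standard axioms); every β-side shape is an UNPRINTED binder; nothing of
Bałaban's is asserted or instantiated; spine PROVED 0∕9 before and after this file; rung (B)+1 on ONE finite T⁴ — NOT ℝ⁴, NOT
infinite volume, NOT a mass gap, NOT Clay.

References (TYPES only): [Balaban1987RG1] = T. Bałaban, Commun. Math. Phys. **109** (1987) 249–301, (0.20) p. 256, Thm 2 p. 259,
(0.31) p. 259, p. 264, §5 p. 298; [King1986] = C. King, Commun. Math. Phys. **102** (1986) 649–677, Thm 3.4 (3.9) p. 656, (3.13) p. 657.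
-/

noncomputable section

namespace Summit.QuantumFields.BalabanUV.T4Continuum.Spine.NE4.KingCurrencyWindow

open Finset Filter Topology
open Literature.MathematicalPhysics.QuantumFieldTheory.Balaban1983to89
open Literature.MathematicalPhysics.QuantumFieldTheory.Balaban1983to89.FlowStep
open Literature.MathematicalPhysics.QuantumFieldTheory.Balaban1983to89.T4CouplingMatching
open Summit.QuantumFields.BalabanUV.T4Continuum.Spine.NE4.KingCurrency
open Summit.QuantumFields.BalabanUV.T4Continuum.Spine.NE4.KingCurrencyAF
  (coupling_le_inv_sprof sprof_monotone exists_inv_sprof_le abs_sub_le_of_pos_le sum_range_pow_sub_le)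
open Summit.QuantumFields.BalabanUV.T4Continuum.NE9.DirectPairing (exists_pow_le)
open Summit.QuantumFields.BalabanUV.T4Continuum.NE7PairwiseCouplingStep (sum_weightsOff_le_of_eventualLower)

/-! ## §4 Node U2 in King's currency: the direct matching of two pinned runs `n` cutoffs apart, on an infrared window -/

/-- **NODE U2 IN KING'S CURRENCY (the direct matching of two pinned runs `n` cutoffs apart, on an infrared window).**  Two runs
of (0.20) with the SAME history-dependent family `β` — A: `K` steps, B: `K + n` steps — all couplings in `]0,γ]`, pinned
`g^A_K = g^B_{K+n}`; the King-currency input `UniformShift ω γ β` with `ω ≥ 0`; history moduli `HistLipschitz Λ γ β` with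
`FadingMemory C θ Λ`; the eventual AF lower bound `EventualLowerH b γ k₀ β`; SMALLNESS `C·((k₀+1)γ³ + 2γ∕b) ≤ (1−θ)∕2` (the
consecutive kernel's).  THEN on every infrared window `[J, K]`, UNIFORMLY IN `n`:
`|1∕(g^A_j)² − 1∕(g^B_{j+n})²| ≤ 2·Σ_{i∈[J,K)} ω_i + 2(C∕(1−θ))·Σ_{i<J} θ^{J−i}·|g^B_{i+n} − g^A_i|`
— the sources ON the window plus the far-ultraviolet couplings seen through the fading memory.  NO RATE of the β-side is used or
produced.  (`discAt_step` + `king_fixedPoint`; the far-UV term is made small by asymptotic freedom in §5.)  Every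
hypothesis about `β` is an UNPRINTED input. [cite: Balaban1987RG1, (0.20) p.256 and §5 p.298] -/
theorem discAt_le_window {β : HBeta} {γ b θ C : ℝ} {ω : ℕ → ℝ} {Λ : ℕ → ℕ → ℝ} {k₀ K n J : ℕ}
    {gA gB : ℕ → ℝ} (hγ : 0 < γ) (hb : 0 < b) (hθ0 : 0 < θ) (hθ1 : θ < 1) (hC : 0 ≤ C)
    (hω : ∀ j, 0 ≤ ω j)
    (hA : RGEqH K β gA) (hB : RGEqH (K + n) β gB)
    (hAbox : ∀ i, i ≤ K → 0 < gA i ∧ gA i ≤ γ) (hBbox : ∀ i, i ≤ K + n → 0 < gB i ∧ gB i ≤ γ)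
    (hpin : gA K = gB (K + n))
    (hS : UniformShift ω γ β) (hL : HistLipschitz Λ γ β) (hΛ : FadingMemory C θ Λ)
    (hlo : EventualLowerH b γ k₀ β) (hsmall : C * (((k₀ : ℝ) + 1) * γ ^ 3 + 2 * γ / b) ≤ (1 - θ) / 2)
    (hJK : J ≤ K) :
    ∀ j, J ≤ j → j ≤ K →
      discAt n gA gB j ≤ 2 * ∑ i ∈ Ico J K, ω i
        + 2 * (C / (1 - θ)) * ∑ i ∈ range J, θ ^ (J - i) * |gB (i + n) - gA i| := by
  set u : ℕ → ℝ := fun i => (gA i) ^ 2 * |gB (i + n)| with hu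
  have hu0 : ∀ i, 0 ≤ u i := fun i => mul_nonneg (sq_nonneg _) (abs_nonneg _)
  have hueq : ∀ i, i ≤ K → u i = (gA i) ^ 2 * gB (i + n) := fun i hi => by
    simp only [hu, abs_of_pos (hBbox (i + n) (by omega)).1]
  -- the total AF weight on the window
  have hU : ∑ i ∈ Ico J K, u i ≤ ((k₀ : ℝ) + 1) * γ ^ 3 + 2 * γ / b := by
    calc ∑ i ∈ Ico J K, u i ≤ ∑ i ∈ range (K + 1), u i :=
          Finset.sum_le_sum_of_subset_of_nonneg
            (fun i hi => mem_range.mpr (by have := (Finset.mem_Ico.mp hi).2; omega)) fun i _ _ => hu0 i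
      _ = ∑ i ∈ range (K + 1), (gA i) ^ 2 * gB (i + n) :=
          Finset.sum_congr rfl fun i hi => hueq i (Nat.lt_succ_iff.mp (mem_range.mp hi))
      _ ≤ ((k₀ : ℝ) + 1) * γ ^ 3 + 2 * γ / b := sum_weightsOff_le_of_eventualLower hγ hb hA hB hAbox hBbox hlo
  set Φ := ∑ i ∈ range J, θ ^ (J - i) * |gB (i + n) - gA i| with hΦ
  have hΦ0 : 0 ≤ Φ := Finset.sum_nonneg fun i _ => mul_nonneg (pow_nonneg hθ0.le _) (abs_nonneg _)
  refine king_fixedPoint hJK hθ0.le hθ1 hC hΦ0 (discAt_nonneg n gA gB) hω hu0 hU hsmall (discAt_pin hpin) ?_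
  intro j hJj hjK
  have hstep := discAt_step hA hB hAbox hBbox hS hL hjK
  -- split the history sum at `J`: far-ultraviolet scales through the fading memory, window scales through the weights
  have hsplit : ∑ i ∈ range (j + 1), Λ j i * |gB (i + n) - gA i|
      = ∑ i ∈ range J, Λ j i * |gB (i + n) - gA i|
        + ∑ i ∈ Ico J (j + 1), Λ j i * |gB (i + n) - gA i| :=
    (Finset.sum_range_add_sum_Ico _ (by omega : J ≤ j + 1)).symm
  have hfar : ∑ i ∈ range J, Λ j i * |gB (i + n) - gA i| ≤ C * θ ^ (j - J) * Φ := by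
    rw [hΦ, Finset.mul_sum]
    refine Finset.sum_le_sum fun i hi => ?_
    have hiJ : i < J := mem_range.mp hi
    have hΛle := (hΛ j i (by omega)).2
    have e : θ ^ (j - i) = θ ^ (j - J) * θ ^ (J - i) := by
      rw [← pow_add]
      congr 1
      omega
    calc Λ j i * |gB (i + n) - gA i| ≤ C * θ ^ (j - i) * |gB (i + n) - gA i| :=
          mul_le_mul_of_nonneg_right hΛle (abs_nonneg _)
      _ = C * θ ^ (j - J) * (θ ^ (J - i) * |gB (i + n) - gA i|) := by rw [e]; ring
  have hnear : ∑ i ∈ Ico J (j + 1), Λ j i * |gB (i + n) - gA i|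
      ≤ C * ∑ i ∈ Ico J (j + 1), θ ^ (j - i) * (u i * discAt n gA gB i) := by
    rw [Finset.mul_sum]
    refine Finset.sum_le_sum fun i hi => ?_
    have hij : i ≤ j := Nat.lt_succ_iff.mp (Finset.mem_Ico.mp hi).2
    have hiK : i ≤ K := hij.trans hjK.le
    have hΛle := (hΛ j i hij).2
    have hgA := hAbox i hiK
    have hgB := hBbox (i + n) (by omega)
    have hcap : |gB (i + n) - gA i| ≤ u i * discAt n gA gB i := by
      rw [hueq i hiK]
      exact abs_sub_le_weight_mul_discAt hgA.1 hgB.1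
    have hCθ : 0 ≤ C * θ ^ (j - i) := mul_nonneg hC (pow_nonneg hθ0.le _)
    calc Λ j i * |gB (i + n) - gA i| ≤ C * θ ^ (j - i) * (u i * discAt n gA gB i) :=
          mul_le_mul hΛle hcap (abs_nonneg _) hCθ
      _ = C * (θ ^ (j - i) * (u i * discAt n gA gB i)) := by ring
  linarith [hstep, hsplit, hfar, hnear]

/-! ## §5 The far-ultraviolet term is small by asymptotic freedom; the qualitative END uniformly in `n` -/

/-- **THE FAR-ULTRAVIOLET TERM IS SMALL BY ASYMPTOTIC FREEDOM.**  Two runs of (0.20) (A: `K` steps, B: `K + n` steps, couplings in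
`]0,γ]`) with `EventualLowerH b γ k₀ β`; a window edge `J` with `k₀ ≤ J ≤ K`.  Then
`Σ_{i<J} θ^{J−i}·|g^B_{i+n} − g^A_i| ≤ k₀·γ·θ^{J−k₀} + (θ∕(1−θ))·(1∕sprof γ b (K+1−J))`:
the first `k₀` scales are `≥ J − k₀` steps away through the fading memory, the others are `≥ K + 1 − J` steps above the infrared
end where both couplings are small (`coupling_le_inv_sprof`). [cite: Balaban1987RG1, (0.31) p.259] -/
theorem farUV_le {β : HBeta} {γ b θ : ℝ} {k₀ K n J : ℕ} {gA gB : ℕ → ℝ} (hγ : 0 < γ) (hb : 0 < b)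
    (hθ0 : 0 ≤ θ) (hθ1 : θ < 1)
    (hA : RGEqH K β gA) (hB : RGEqH (K + n) β gB)
    (hAbox : ∀ i, i ≤ K → 0 < gA i ∧ gA i ≤ γ) (hBbox : ∀ i, i ≤ K + n → 0 < gB i ∧ gB i ≤ γ)
    (hlo : EventualLowerH b γ k₀ β) (hk₀J : k₀ ≤ J) (hJK : J ≤ K) :
    ∑ i ∈ range J, θ ^ (J - i) * |gB (i + n) - gA i|
      ≤ (k₀ : ℝ) * γ * θ ^ (J - k₀) + θ / (1 - θ) * (1 / sprof γ b (K + 1 - J)) := by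
  have hp0 := sprof_pos hγ hb.le
  set s := 1 / sprof γ b (K + 1 - J) with hs
  have hs0 : 0 ≤ s := (one_div_pos.mpr (hp0 _)).le
  rw [← Finset.sum_range_add_sum_Ico _ hk₀J]
  -- the first `k₀` scales: `|Δg| ≤ γ`, `θ^{J−i} ≤ θ^{J−k₀}`
  have hyoung : ∑ i ∈ range k₀, θ ^ (J - i) * |gB (i + n) - gA i| ≤ (k₀ : ℝ) * γ * θ ^ (J - k₀) := by
    calc ∑ i ∈ range k₀, θ ^ (J - i) * |gB (i + n) - gA i| ≤ ∑ i ∈ range k₀, θ ^ (J - k₀) * γ := by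
          refine Finset.sum_le_sum fun i hi => ?_
          have hi' : i < k₀ := mem_range.mp hi
          have hθle : θ ^ (J - i) ≤ θ ^ (J - k₀) := pow_le_pow_of_le_one hθ0 hθ1.le (by omega)
          have hgA := hAbox i (by omega)
          have hgB := hBbox (i + n) (by omega)
          exact mul_le_mul hθle (abs_sub_le_of_pos_le hgB.1 hgB.2 hgA.1 hgA.2) (abs_nonneg _) (pow_nonneg hθ0 _)
      _ = (k₀ : ℝ) * γ * θ ^ (J - k₀) := by
          rw [Finset.sum_const, Finset.card_range, nsmul_eq_mul]
          ring
  -- the scales `k₀ ≤ i < J`: both couplings `≤ s` by asymptotic freedom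
  have hold : ∑ i ∈ Ico k₀ J, θ ^ (J - i) * |gB (i + n) - gA i| ≤ θ / (1 - θ) * s := by
    calc ∑ i ∈ Ico k₀ J, θ ^ (J - i) * |gB (i + n) - gA i| ≤ ∑ i ∈ Ico k₀ J, θ ^ (J - i) * s := by
          refine Finset.sum_le_sum fun i hi => ?_
          have hik : k₀ ≤ i := (Finset.mem_Ico.mp hi).1
          have hiJ : i < J := (Finset.mem_Ico.mp hi).2
          have hgA := hAbox i (by omega)
          have hgB := hBbox (i + n) (by omega)
          have hmono : sprof γ b (K + 1 - J) ≤ sprof γ b (K - i) := sprof_monotone hb.le (by omega)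
          have hsi : 1 / sprof γ b (K - i) ≤ s := one_div_le_one_div_of_le (hp0 _) hmono
          have hcA : gA i ≤ s := (coupling_le_inv_sprof hγ hb hA hAbox hlo hik (by omega)).trans hsi
          have hcB : gB (i + n) ≤ s := by
            have h := coupling_le_inv_sprof hγ hb hB hBbox hlo (i := i + n) (by omega) (by omega)
            rw [show K + n - (i + n) = K - i by omega] at h
            exact h.trans hsi
          exact mul_le_mul_of_nonneg_left (abs_sub_le_of_pos_le hgB.1 hcB hgA.1 hcA) (pow_nonneg hθ0 _)
      _ = (∑ i ∈ Ico k₀ J, θ ^ (J - i)) * s := by rw [Finset.sum_mul]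
      _ ≤ (∑ i ∈ range J, θ ^ (J - i)) * s := by
          refine mul_le_mul_of_nonneg_right ?_ hs0
          exact Finset.sum_le_sum_of_subset_of_nonneg
            (fun i hi => mem_range.mpr (Finset.mem_Ico.mp hi).2) fun _ _ _ => pow_nonneg hθ0 _
      _ ≤ θ / (1 - θ) * s := mul_le_mul_of_nonneg_right (sum_range_pow_sub_le hθ0 hθ1 J) hs0
  linarith

/-- **NODE U2 IN KING'S CURRENCY — THE END ON THE RUNS (qualitative, uniformly in the gap `n`).**  A family of runs `K ↦ g^{(K)}` of
(0.20) with the same history-dependent `β` (`RGEqH K β (g K)`), couplings in `]0,γ]`, all pinned at the same renormalized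
coupling (`g K K = g_IR`, [Balaban1987RG1] Thm 2's `g_K = g`); the RATE-FREE King-currency input `UniformShift ω γ β` with `ω ≥ 0`
and `ω → 0`; history moduli with `FadingMemory C θ`; the eventual AF lower bound; the consecutive kernel's smallness
`C((k₀+1)γ³ + 2γ∕b) ≤ (1−θ)∕2`.  THEN for every depth `M` and every `ε > 0` there is `K₀` such that for all `K ≥ K₀`, ALL `n` and
all scales `j` with `K − M ≤ j ≤ K`: `|g^{(K+n)}_{j+n} − g^{(K)}_j| ≤ ε` — the couplings of the runs `K` and `K + n` match at every
fixed infrared depth, uniformly in `n`.  No rate of the β-side is used or produced (window `J = K − D` with `D` chosen by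
asymptotic freedom, then `K` large against `ω → 0` and the fading memory).  Every hypothesis about `β` is an UNPRINTED input.
[cite: Balaban1987RG1, (0.20) p.256, Thm 2 p.259, (0.31) p.259] -/
theorem direct_matching_eventually {β : HBeta} {γ b θ C : ℝ} {ω : ℕ → ℝ} {Λ : ℕ → ℕ → ℝ} {k₀ : ℕ}
    (g : ℕ → ℕ → ℝ) (gIR : ℝ) (hγ : 0 < γ) (hb : 0 < b) (hθ0 : 0 < θ) (hθ1 : θ < 1) (hC : 0 ≤ C)
    (hrun : ∀ K, RGEqH K β (g K)) (hbox : ∀ K i, i ≤ K → 0 < g K i ∧ g K i ≤ γ) (hpin : ∀ K, g K K = gIR)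
    (hS : UniformShift ω γ β) (hω0 : ∀ j, 0 ≤ ω j) (hωlim : Tendsto ω atTop (𝓝 0))
    (hL : HistLipschitz Λ γ β) (hΛ : FadingMemory C θ Λ) (hlo : EventualLowerH b γ k₀ β)
    (hsmall : C * (((k₀ : ℝ) + 1) * γ ^ 3 + 2 * γ / b) ≤ (1 - θ) / 2) :
    ∀ (M : ℕ) (ε : ℝ), 0 < ε → ∃ K₀ : ℕ, ∀ K n j : ℕ, K₀ ≤ K → K ≤ j + M → j ≤ K →
      |g (K + n) (j + n) - g K j| ≤ ε := by
  intro M ε hε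
  have h1θ : 0 < 1 - θ := by linarith
  have hγ3 : 0 < γ ^ 3 := by positivity
  -- the discrepancy target
  set ε₁ := ε / γ ^ 3 with hε₁
  have hε₁pos : 0 < ε₁ := by positivity
  set c₁ := 2 * (C / (1 - θ)) with hc₁
  have hc₁0 : 0 ≤ c₁ := by positivity
  -- (i) the window depth `D` by asymptotic freedom
  obtain ⟨D₁, hD₁⟩ := exists_inv_sprof_le hγ hb
    (ε := ε₁ / 3 / (c₁ * (θ / (1 - θ)) + 1)) (by positivity)
  set D := max M D₁ with hD
  -- (ii) the first `k₀` scales through the fading memory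
  obtain ⟨N₁, hN₁⟩ := exists_pow_le (c₁ * ((k₀ : ℝ) * γ)) hθ0.le hθ1 (ε := ε₁ / 3) (by positivity)
  -- (iii) the sources on the window
  obtain ⟨N₂, hN₂⟩ := Metric.tendsto_atTop.mp hωlim (ε₁ / 3 / (2 * ((D : ℝ) + 1))) (by positivity)
  refine ⟨N₁ + N₂ + D + k₀, fun K n j hK hjM hjK => ?_⟩
  have hKD : D + k₀ ≤ K := by omega
  set J := K - D with hJ
  have hJK : J ≤ K := Nat.sub_le K D
  have hk₀J : k₀ ≤ J := by omega
  have hJj : J ≤ j := by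
    have : M ≤ D := le_max_left _ _
    omega
  -- node U2 on the window
  have hwin := discAt_le_window hγ hb hθ0 hθ1 hC hω0 (hrun K) (hrun (K + n)) (hbox K) (hbox (K + n))
    ((hpin K).trans (hpin (K + n)).symm) hS hL hΛ hlo hsmall hJK j hJj hjK
  have hfar := farUV_le hγ hb hθ0.le hθ1 (hrun K) (hrun (K + n)) (hbox K) (hbox (K + n)) hlo hk₀J hJK
  -- (iii) the window sources are small
  have hsrc : 2 * ∑ i ∈ Ico J K, ω i ≤ ε₁ / 3 := by
    have hωi : ∀ i ∈ Ico J K, ω i ≤ ε₁ / 3 / (2 * ((D : ℝ) + 1)) := by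
      intro i hi
      have hiN : N₂ ≤ i := by have := (Finset.mem_Ico.mp hi).1; omega
      have h := hN₂ i hiN
      rw [Real.dist_eq, sub_zero] at h
      exact (le_abs_self _).trans h.le
    have hcard : ((Ico J K).card : ℝ) ≤ (D : ℝ) := by
      rw [Nat.card_Ico]
      exact_mod_cast (by omega : K - J ≤ D)
    have hD0 : (0 : ℝ) ≤ (D : ℝ) := by positivity
    calc 2 * ∑ i ∈ Ico J K, ω i ≤ 2 * ∑ i ∈ Ico J K, ε₁ / 3 / (2 * ((D : ℝ) + 1)) :=
          mul_le_mul_of_nonneg_left (Finset.sum_le_sum hωi) (by norm_num)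
      _ = 2 * ((Ico J K).card * (ε₁ / 3 / (2 * ((D : ℝ) + 1)))) := by rw [Finset.sum_const, nsmul_eq_mul]
      _ ≤ 2 * ((D : ℝ) * (ε₁ / 3 / (2 * ((D : ℝ) + 1)))) :=
          mul_le_mul_of_nonneg_left (mul_le_mul_of_nonneg_right hcard (by positivity)) (by norm_num)
      _ = (D : ℝ) / ((D : ℝ) + 1) * (ε₁ / 3) := by field_simp
      _ ≤ 1 * (ε₁ / 3) := by
          refine mul_le_mul_of_nonneg_right ?_ (by positivity)
          rw [div_le_one (by positivity)]
          linarith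
      _ = ε₁ / 3 := one_mul _
  -- (ii) the young scales are far
  have hyoung : c₁ * ((k₀ : ℝ) * γ * θ ^ (J - k₀)) ≤ ε₁ / 3 := by
    have h := hN₁ (J - k₀) (by omega)
    calc c₁ * ((k₀ : ℝ) * γ * θ ^ (J - k₀)) = c₁ * ((k₀ : ℝ) * γ) * θ ^ (J - k₀) := by ring
      _ ≤ ε₁ / 3 := h
  -- (i) the old scales are asymptotically free
  have hold : c₁ * (θ / (1 - θ) * (1 / sprof γ b (K + 1 - J))) ≤ ε₁ / 3 := by
    have hKJ : D₁ ≤ K + 1 - J := by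
      have : D₁ ≤ D := le_max_right _ _
      omega
    have h := hD₁ (K + 1 - J) hKJ
    have hq : 0 ≤ c₁ * (θ / (1 - θ)) := by positivity
    calc c₁ * (θ / (1 - θ) * (1 / sprof γ b (K + 1 - J)))
        = (c₁ * (θ / (1 - θ))) * (1 / sprof γ b (K + 1 - J)) := by ring
      _ ≤ (c₁ * (θ / (1 - θ))) * (ε₁ / 3 / (c₁ * (θ / (1 - θ)) + 1)) := mul_le_mul_of_nonneg_left h hq
      _ = (c₁ * (θ / (1 - θ))) / (c₁ * (θ / (1 - θ)) + 1) * (ε₁ / 3) := by ring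
      _ ≤ 1 * (ε₁ / 3) := by
          refine mul_le_mul_of_nonneg_right ?_ (by positivity)
          rw [div_le_one (by positivity)]
          linarith
      _ = ε₁ / 3 := one_mul _
  -- the discrepancy, then the coupling difference
  have hdisc : discAt n (g K) (g (K + n)) j ≤ ε₁ := by
    have hΦ := mul_le_mul_of_nonneg_left hfar hc₁0
    rw [mul_add] at hΦ
    have e : 2 * (C / (1 - θ)) = c₁ := rfl
    rw [e] at hwin
    linarith
  have hgA := hbox K j hjK
  have hgB := hbox (K + n) (j + n) (by omega)
  have hw : (g K j) ^ 2 * g (K + n) (j + n) ≤ γ ^ 3 := by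
    calc (g K j) ^ 2 * g (K + n) (j + n) ≤ γ ^ 2 * γ :=
          mul_le_mul (pow_le_pow_left₀ hgA.1.le hgA.2 2) hgB.2 hgB.1.le (sq_nonneg γ)
      _ = γ ^ 3 := by ring
  calc |g (K + n) (j + n) - g K j| ≤ (g K j) ^ 2 * g (K + n) (j + n) * discAt n (g K) (g (K + n)) j :=
        abs_sub_le_weight_mul_discAt hgA.1 hgB.1
    _ ≤ γ ^ 3 * ε₁ := mul_le_mul hw hdisc (discAt_nonneg _ _ _ _) hγ3.le
    _ = ε := by rw [hε₁]; field_simp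

end Summit.QuantumFields.BalabanUV.T4Continuum.Spine.NE4.KingCurrencyWindow
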